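import Summits.QuantumFields.YangMills.Theses.BalabanUVNodes
import Summits.QuantumFields.YangMills.Theorems.BalabanUVNodesK1WindowKOfRunRowsSurvivors

/-!
# Route `BalabanUVNodes` rev 26∕27 (director-ym №29 PRESS Variant Rʳ; plan g84 RUNBOOK op 4): THE K2⁸ CLOSER — `EndpointGivenRunRowsR13SepCoPH` (support r9, stmt-QuantumFields-26908) HOLDS OUTRIGHT

Cell pub-balaban (b2b), seat `b2b-balaban-beta-an4` (BINDER row D4 OWNER), gen 153; `--kind proof --workitem stmt-QuantumFields-26908` (plan g84 `[YMPLAN-G84-REV26R-LANDED]`, pub-ymgap I.31700: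
«OP 4 IS YOURS NOW»).  The item: K2⁷'s text with the RUN ROWS displayed as hypothesis — at a Stage-13 tuple carrying unity ∧ slots, admissibility and (B), SOME reference sequence `b`, radius
`r`, window `γ₀ > 0` and floor `M` with the run-wise constant remainder `|β_{k+1}(g_0,…,g_k) − b_k| ≤ r` of the record's β `Node00.betaOfRecord₁₃ F 2 θ.toStage13Params` along every in-window
RG run, the run-wise partial-sum floor `−M`, and survivor continuity at level `γ₀` (bodies inlined in the item text), and the window clause ⟹ the endpoint-existence half of [I] Thm 2 for the
datum's construction.  PROOF: node n24's END `BalabanUVNodesK1WindowKOfRunRowsSurvivors.endpointExistence_datumOfRecord₁₃SepCoPH_of_runRows_survCont` BY NAME (dag-n24-w1; itself DEF-1's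
`endpointExistence_of_runConstRemainder_runwisePS_survCont` at the datum's forward generation); unity, admissibility, (B) and the window are NOT read.

HONEST FRAMING.  This closes a BORN-CLOSED SUPPORT item (r9) — a DISPLAY of the rung's END step under the rev-26ᴿ shape; it moves NO load-bearing crux (after rev 27 the open cruxes of the cone are
K0⁷ 20541, K1⁸ 26907 (DECIDING; it now OWES the rows at its witness) and K3⁷ 20544), discharges NO node of the 28, proves NO registered stub, asserts NOTHING of Bałaban's analysis; counts unmoved
by this file; [Balaban1987RG1] Thm 2 + (0.31) p. 259 and §1's continuity (pp. 263–264) are UNPROVED IN PRINT; route R4 closes the CONDITIONAL finite-𝕋⁴ rung `BalabanLadder.UV` only — ONE kernel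
implication on ONE finite 𝕋⁴ at fixed ε; NOT the continuum limit, NOT ℝ⁴, NOT OS, NOT the Yang–Mills mass gap, NOT Clay.  No `def`, no `instance`, no `notation`, no `axiom`.
Sources (context only): [I] = [Balaban1987RG1] CMP **109** (1987): Thm 2 p. 259 (first sentence), Thm 3 p. 264, (1.20)–(1.22) p. 264, (5.10) p. 293, §1 pp. 263–264.
-/

noncomputable section

namespace Summit.QuantumFields.YangMills.Theorems.BalabanUVNodesK2R8Holds

open Summit.QuantumFields.YangMills.Theorems.BalabanUVNodesK1WindowKOfRunRowsSurvivors (endpointExistence_datumOfRecord₁₃SepCoPH_of_runRows_survCont)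

/-- **K2⁸ `EndpointGivenRunRowsR13SepCoPH` HOLDS** (route `BalabanUVNodes` rev 26, support r9, stmt-QuantumFields-26908): the displayed run rows (i) run-wise constant remainder, (iv) partial-sum floor,
and run-wise (C) at one window `γ₀ > 0` give the endpoint-existence half of [I] Thm 2 for the Stage-13 datum — node n24's END BY NAME; unity, admissibility, (B), the window clause unused.
CLOSES a born-closed SUPPORT item only; K1⁸ owes the rows. [cite: Balaban1987RG1, Thm 2 p.259 (first sentence), Thm 3 p.264 and (5.10) p.293] -/
theorem endpointGivenRunRowsR13SepCoPH_holds : Summit.QuantumFields.YangMills.Theses.BalabanUVNodes.EndpointGivenRunRowsR13SepCoPH := by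
  intro F θ h _ _ _ hrows _
  obtain ⟨b, r, γ₀, M, hγ₀, hrem, hps, hsc⟩ := hrows
  exact endpointExistence_datumOfRecord₁₃SepCoPH_of_runRows_survCont θ h hγ₀ hrem hps hsc

end Summit.QuantumFields.YangMills.Theorems.BalabanUVNodesK2R8Holds

end
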